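import Literature.Topology.FourManifolds.SPC4Spin
import Literature.Topology.FourManifolds.SpinSphereStableProofs
import HarnessLib

/-!
# The `4`-sphere is spin (discharge)

Proof file attached to `Literature/Topology/FourManifolds/SPC4Spin.lean`. It discharges, sorry-free,
the named fact

* `Literature.Topology.FourManifolds.isSpin_sphere_four_holds : isSpin_sphere_four` — `𝕊⁴` is spin,

as the case `n = 4` of `Literature.Topology.FourManifolds.isSpin_sphere_holds`
(`SpinSphereStableProofs.lean`: every sphere is orientable and stably parallelizable, hence spin;
Lawson–Michelsohn, *Spin Geometry* (1989), Ch. II, Thm 2.1 and the examples following it,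
`w(T𝕊ⁿ) = 1`). This restores the interim proof `isSpin_sphere 4` recorded in `SPC4Spin.lean`.

Theorems only; no definitions.

## References

* H. B. Lawson, M.-L. Michelsohn, *Spin Geometry*, Princeton (1989), Ch. II, Thm 2.1.
  [LawsonMichelsohn1989]
* A. A. Kosinski, *Differential Manifolds* (1993), Ch. IX §7 (spheres are π-manifolds).
  [Kosinski1993]
-/

noncomputable section

namespace Literature.Topology.FourManifolds

/-- **`𝕊⁴` is spin**: discharge of the named fact `Literature.Topology.FourManifolds.isSpin_sphere_four` of `SPC4Spin.lean`,
the case `n = 4` of `isSpin_sphere_holds` (Lawson–Michelsohn, *Spin Geometry*, Ch. II, Thm 2.1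
and examples: `w(T𝕊ⁿ) = 1`). [cite: LawsonMichelsohn1989, Ch. II Thm 2.1 and examples] -/
theorem isSpin_sphere_four_holds : isSpin_sphere_four :=
  isSpin_sphere_holds 4

end Literature.Topology.FourManifolds
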